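import Mathlib
import HarnessLib
import Summits.Ventures.LatticeQCDFlow.Exactness.SUNMultiStepLeapfrogHMC

/-!
# `SU(N)` rung in general coordinates — what the step size does to the engine's leapfrog proposal: THE CHAIN RULE IN THE STEP SIZE (`D^ε S = ε·D¹S`, a represented force field scales by `ε` with its bounds) and THE REVERSIBILITY TEST AT EVERY STEP SIZE (forward·flip·backward·flip = id, round-trip energy violation exactly `0`)

HONEST FRAMING: exact (Metropolis-corrected) sampling algorithms for lattice gauge theory;
figures of merit are autocorrelation/cost numbers at stated couplings and volumes; no
continuum-physics claim.

Venture `LatticeQCDFlow` (cell pub-lqcd), topic `Exactness`; FANOUT row 14 (`eng-flowhmc`, engine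
`latflow.fthmc`, family B; the row's test columns «reversibility (|δH| round trip)» and «acceptance vs step size» on
the `SU(N)` rung of rows 21–26).  The general-coordinates twins of `SU2WilsonFlowLOLeapfrogEnergyError` §1 (the
chain rule for the Pauli drift) and of `LeapfrogReversibilityTest` (`SU(2)` / `U(1)` rungs).  NEW WORK of the cell over
the tree: row 9's kernel of record `SUNLeapfrogHMC` / `SUNMultiStepLeapfrogHMC` (`sunExpDrift ι hι ε`,
`sunLeapfrogProposalN ι hι ε g n = flip ∘ (palindromicWord [kick g] (drift (mulDrift (sunExpDrift ι hι ε))))ⁿ`,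
`involutive_sunLeapfrogProposalN`), `SUNProductTrajectory` (`coeConfig`), Mathlib (chain rule); nothing is cited as a
fact; no number.  Companion of `SUNExpDriftWork` / `SUNLeapfrogEnergyError` (whose bounds carry `D_max`, `K` of the
`ε`-step force field `D = D^ε S`; §1 here says `D^ε S = ε·D¹S`, so `D_max = |ε|Φ_max`, `K = |ε|K_Φ` and those bounds
are `O(nε²)` explicitly).

* §1 `sunExpDrift_eq_unit_smul` (`e_ε(a) = e_1(εa)`), `action_sunExpDrift_eq_comp`,
  **`hasFDerivAt_action_sunExpDrift_of_unit`** / `differentiableAt_action_sunExpDrift_of_unit` (differentiability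
  along `e_ε` at zero momentum from differentiability along `e_1` — the form in which member files type it),
  **`fderiv_action_sunExpDrift_apply_of_unit`** — THE CHAIN RULE IN THE STEP SIZE
  `D(a ↦ S(e_ε(a)·W))(0)[v] = ε·D(a ↦ S(e_1(a)·W))(0)[v]`; **`sunForce_pairing_smul`** — if `Φ` represents the
  unit-step differential through a pairing `B` (`= Σ_l B(Φ(W)_l, δ_l)`), then `ε•Φ` represents the `ε`-step one;
  `norm_smul_force_apply_le` (`‖εΦ(W)_l‖ ≤ |ε|Φ_max`), `norm_smul_force_sub_le` (`ε•Φ` is `|ε|K_Φ`-Lipschitz in the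
  matrix sup norm when `Φ` is `K_Φ`-Lipschitz), `sunHalfKick_smul` (the consistent half kick `−(εΦ)/(4κ) = −(ε/(4κ))•Φ`).
* §2 **`sunLeapfrog_forward_flip_backward`** — for EVERY force field `g`, step size `ε`, number of steps `n` and
  phase-space point: `flip (Wⁿ (flip (Wⁿ z))) = z` for the engine's word `W = palindromicWord [kick g] (drift (mulDrift e_ε))`
  (forward, flip, backward, flip is the identity); **`sunLeapfrogProposalN_roundTrip_energy`** — the round-trip change
  of ANY phase-space function is exactly `0`; `sunLeapfrogProposalN_roundTrip_abs_energy_le` — hence the row's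
  reversibility test (`|δH|` after forward–flip–backward–flip `≤ δ`) passes at every tolerance `δ ≥ 0` in exact
  arithmetic, for every Hamiltonian, on the `SU(N)` rung in any coordinates (the engine's `1e−9` is a floating-point
  statement, not claimed).

NOT CLAIMED: floating-point round-off (the only thing the numerical reversibility test actually measures beyond this
identity); anything about which `Φ` a member realises; any number.
-/

noncomputable section

namespace Summit.Ventures.LatticeQCDFlow.Exactness

open Set Function NormedSpace
open scoped Matrix Matrix.Norms.Operator

set_option backward.isDefEq.respectTransparency false

variable {n : Type*} [Fintype n] [DecidableEq n]
variable {E : Type*} [NormedAddCommGroup E] [NormedSpace ℝ E]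
variable (ι : E →ₗ[ℝ] Matrix n n ℂ) (hι : ∀ a, (ι a)ᴴ = -ι a ∧ (ι a).trace = 0)
variable {L : Type*}

/-! ## §1 The chain rule in the step size -/

section ChainRule

/-- `e_ε(a) = e_1(ε a)`: the `ε`-step drift factors are the unit-step ones at the scaled momenta. -/
theorem sunExpDrift_eq_unit_smul (ε : ℝ) (a : L → E) : sunExpDrift ι hι ε a = sunExpDrift ι hι 1 (ε • a) := by
  funext l
  simp only [sunExpDrift_apply, Pi.smul_apply, one_smul]

/-- `a ↦ S(e_ε(a)·W)` is `a ↦ S(e_1(a)·W)` precomposed with `a ↦ εa`. -/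
theorem action_sunExpDrift_eq_comp (S : (L → Matrix.specialUnitaryGroup n ℂ) → ℝ) (ε : ℝ)
    (W : L → Matrix.specialUnitaryGroup n ℂ) :
    (fun a : L → E => S (sunExpDrift ι hι ε a * W)) =
      (fun a : L → E => S (sunExpDrift ι hι 1 a * W)) ∘ fun a : L → E => ε • a := by
  funext a
  simp only [Function.comp_apply, sunExpDrift_eq_unit_smul ι hι ε a]

variable [Fintype L]

/-- **Differentiability along `e_ε` at zero momentum follows from differentiability along `e_1`**, with the
derivative `D(a ↦ S(e_1(a)·W))(0) ∘ (ε·id)`. -/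
theorem hasFDerivAt_action_sunExpDrift_of_unit (S : (L → Matrix.specialUnitaryGroup n ℂ) → ℝ) (ε : ℝ)
    (W : L → Matrix.specialUnitaryGroup n ℂ)
    (hd1 : DifferentiableAt ℝ (fun a : L → E => S (sunExpDrift ι hι 1 a * W)) 0) :
    HasFDerivAt (fun a : L → E => S (sunExpDrift ι hι ε a * W))
      ((fderiv ℝ (fun a : L → E => S (sunExpDrift ι hι 1 a * W)) 0).comp (ε • ContinuousLinearMap.id ℝ (L → E))) 0 := by
  have h0 : (fun a : L → E => ε • a) 0 = 0 := smul_zero ε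
  have hO : HasFDerivAt (fun a : L → E => S (sunExpDrift ι hι 1 a * W))
      (fderiv ℝ (fun a : L → E => S (sunExpDrift ι hι 1 a * W)) 0) ((fun a : L → E => ε • a) 0) := by
    rw [h0]
    exact hd1.hasFDerivAt
  rw [action_sunExpDrift_eq_comp]
  exact hO.comp (0 : L → E) ((hasFDerivAt_id (0 : L → E)).const_smul ε)

/-- Differentiability along `e_ε` at zero momentum. -/
theorem differentiableAt_action_sunExpDrift_of_unit (S : (L → Matrix.specialUnitaryGroup n ℂ) → ℝ) (ε : ℝ)
    (W : L → Matrix.specialUnitaryGroup n ℂ)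
    (hd1 : DifferentiableAt ℝ (fun a : L → E => S (sunExpDrift ι hι 1 a * W)) 0) :
    DifferentiableAt ℝ (fun a : L → E => S (sunExpDrift ι hι ε a * W)) 0 :=
  (hasFDerivAt_action_sunExpDrift_of_unit ι hι S ε W hd1).differentiableAt

/-- **THE CHAIN RULE IN THE STEP SIZE**: `D(a ↦ S(e_ε(a)·W))(0)[v] = ε · D(a ↦ S(e_1(a)·W))(0)[v]`. -/
theorem fderiv_action_sunExpDrift_apply_of_unit (S : (L → Matrix.specialUnitaryGroup n ℂ) → ℝ) (ε : ℝ)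
    (W : L → Matrix.specialUnitaryGroup n ℂ)
    (hd1 : DifferentiableAt ℝ (fun a : L → E => S (sunExpDrift ι hι 1 a * W)) 0) (v : L → E) :
    fderiv ℝ (fun a : L → E => S (sunExpDrift ι hι ε a * W)) 0 v =
      ε * fderiv ℝ (fun a : L → E => S (sunExpDrift ι hι 1 a * W)) 0 v := by
  rw [(hasFDerivAt_action_sunExpDrift_of_unit ι hι S ε W hd1).fderiv, ContinuousLinearMap.comp_apply,
    show (ε • ContinuousLinearMap.id ℝ (L → E)) v = ε • v from rfl, map_smul, smul_eq_mul]

variable (B : E →ₗ[ℝ] E →ₗ[ℝ] ℝ)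

/-- **A represented force field scales with the step size**: if `Φ` represents the unit-step differential through the
pairing `B`, `D(a ↦ S(e_1(a)·W))(0)[δ] = Σ_l B(Φ(W)_l, δ_l)`, then `ε•Φ` represents the `ε`-step one. -/
theorem sunForce_pairing_smul (S : (L → Matrix.specialUnitaryGroup n ℂ) → ℝ) (ε : ℝ)
    (hd1 : ∀ W : L → Matrix.specialUnitaryGroup n ℂ, DifferentiableAt ℝ (fun a : L → E => S (sunExpDrift ι hι 1 a * W)) 0)
    (Φ : (L → Matrix.specialUnitaryGroup n ℂ) → L → E)
    (hΦ : ∀ (W : L → Matrix.specialUnitaryGroup n ℂ) (δ : L → E),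
      fderiv ℝ (fun a : L → E => S (sunExpDrift ι hι 1 a * W)) 0 δ = ∑ l, B (Φ W l) (δ l))
    (W : L → Matrix.specialUnitaryGroup n ℂ) (δ : L → E) :
    fderiv ℝ (fun a : L → E => S (sunExpDrift ι hι ε a * W)) 0 δ = ∑ l, B ((ε • Φ) W l) (δ l) := by
  rw [fderiv_action_sunExpDrift_apply_of_unit ι hι S ε W (hd1 W) δ, hΦ W δ, Finset.mul_sum]
  refine Finset.sum_congr rfl fun l _ => ?_
  rw [Pi.smul_apply, Pi.smul_apply, map_smul, LinearMap.smul_apply, smul_eq_mul]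

omit [Fintype L] in
/-- The scaled force field is bounded by `|ε|Φ_max` linkwise. -/
theorem norm_smul_force_apply_le (ε : ℝ) (Φ : (L → Matrix.specialUnitaryGroup n ℂ) → L → E) {Φmax : ℝ}
    (hΦb : ∀ (W : L → Matrix.specialUnitaryGroup n ℂ) (l : L), ‖Φ W l‖ ≤ Φmax)
    (W : L → Matrix.specialUnitaryGroup n ℂ) (l : L) : ‖(ε • Φ) W l‖ ≤ |ε| * Φmax := by
  rw [Pi.smul_apply, Pi.smul_apply, norm_smul, Real.norm_eq_abs]
  exact mul_le_mul_of_nonneg_left (hΦb W l) (abs_nonneg ε)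

/-- The scaled force field is `|ε|K_Φ`-Lipschitz in the matrix sup norm when `Φ` is `K_Φ`-Lipschitz. -/
theorem norm_smul_force_sub_le (ε : ℝ) (Φ : (L → Matrix.specialUnitaryGroup n ℂ) → L → E) {KΦ : ℝ}
    (hΦK : ∀ W W' : L → Matrix.specialUnitaryGroup n ℂ, ‖Φ W - Φ W'‖ ≤ KΦ * ‖coeConfig W - coeConfig W'‖)
    (W W' : L → Matrix.specialUnitaryGroup n ℂ) : ‖(ε • Φ) W - (ε • Φ) W'‖ ≤ |ε| * KΦ * ‖coeConfig W - coeConfig W'‖ := by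
  rw [Pi.smul_apply, Pi.smul_apply, ← smul_sub, norm_smul, Real.norm_eq_abs, mul_assoc]
  exact mul_le_mul_of_nonneg_left (hΦK W W') (abs_nonneg ε)

omit [Fintype L] in
/-- The consistent half kick of the scaled force field: `−(1/(4κ))•(εΦ)(W)_l = −(ε/(4κ))•Φ(W)_l` — the engine's
half kick `−(ε'/2)·Φ_{κ'}` with `Φ_{κ'} = κ'·D¹S̃` is the consistent one of `SUNLeapfrogEnergyError` exactly when
`2κκ' = 1`. -/
theorem sunHalfKick_smul (ε κ : ℝ) (Φ : (L → Matrix.specialUnitaryGroup n ℂ) → L → E)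
    (W : L → Matrix.specialUnitaryGroup n ℂ) (l : L) :
    -(1 / (4 * κ)) • (ε • Φ) W l = -(ε / (4 * κ)) • Φ W l := by
  rw [Pi.smul_apply, Pi.smul_apply, smul_smul]
  congr 1
  ring

end ChainRule

/-! ## §2 The reversibility test at every step size -/

section Reversibility

variable (ε : ℝ) (g : (L → Matrix.specialUnitaryGroup n ℂ) → L → E) (N : ℕ)

/-- **FORWARD, FLIP, BACKWARD, FLIP IS THE IDENTITY** for the engine's `SU(N)` leapfrog word in any coordinates, every
force field `g`, every step size and number of steps. -/
theorem sunLeapfrog_forward_flip_backward (z : (L → Matrix.specialUnitaryGroup n ℂ) × (L → E)) :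
    flip (((palindromicWord [kick g] (drift (mulDrift (sunExpDrift ι hι ε)))) ^ N)
      (flip (((palindromicWord [kick g] (drift (mulDrift (sunExpDrift ι hι ε)))) ^ N) z))) = z := by
  have h := involutive_sunLeapfrogProposalN ι hι ε g N z
  rw [sunLeapfrogProposalN, Equiv.Perm.mul_apply, Equiv.Perm.mul_apply] at h
  exact h

/-- **THE ROUND-TRIP CHANGE OF EVERY PHASE-SPACE FUNCTION IS EXACTLY ZERO.** -/
theorem sunLeapfrogProposalN_roundTrip_energy (H : (L → Matrix.specialUnitaryGroup n ℂ) × (L → E) → ℝ)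
    (z : (L → Matrix.specialUnitaryGroup n ℂ) × (L → E)) :
    H (sunLeapfrogProposalN ι hι ε g N (sunLeapfrogProposalN ι hι ε g N z)) - H z = 0 := by
  rw [involutive_sunLeapfrogProposalN ι hι ε g N z, sub_self]

/-- Hence the reversibility test passes at EVERY tolerance `δ ≥ 0` in exact arithmetic, for every Hamiltonian
`H = S + T`: `|H(Ψ_n(Ψ_n(q,p))) − H(q,p)| ≤ δ`. -/
theorem sunLeapfrogProposalN_roundTrip_abs_energy_le (S : (L → Matrix.specialUnitaryGroup n ℂ) → ℝ) (T : (L → E) → ℝ)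
    {δ : ℝ} (hδ : 0 ≤ δ) (z : (L → Matrix.specialUnitaryGroup n ℂ) × (L → E)) :
    |(S (sunLeapfrogProposalN ι hι ε g N (sunLeapfrogProposalN ι hι ε g N z)).1 +
        T (sunLeapfrogProposalN ι hι ε g N (sunLeapfrogProposalN ι hι ε g N z)).2) - (S z.1 + T z.2)| ≤ δ := by
  rw [sunLeapfrogProposalN_roundTrip_energy ι hι ε g N (fun w => S w.1 + T w.2) z, abs_zero]
  exact hδ

end Reversibility

end Summit.Ventures.LatticeQCDFlow.Exactness
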